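import Mathlib
import Summits.QuantumFields.YangMills.Theses.BackwardLiouvilleRigidity

/-!
# Line «backward-liouville-rigidity» rev 3 (ym-r3-idea-1 g6, lens control) — route `route-QuantumFields-BackwardLiouvilleRigidity`
(items: see the route file — rev 3 restated the rev-2 items 27918–27921 1:1 with the same decl names; rev-1 items 27812–27815 and rev-0 items
27679–27682 retired), closes rung R3 (`T3YM3TorusStatement.YM3TorusSU2`), BYPASSING crux stmt-QuantumFields-20520 `FluctuationComparisonRegPrIntL`
in whose directory this file lives (the seat's write scope). No summit / rung is proved.

REV 3 = REV 2 with the continuity pin LOCALISED TO THE WINDOW: every class clause demands `ContinuousOn (ρ j) {U | PlaqSmall (θBal F.L γ b₀ p₀ j) U}`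
for ρ and ρ′ (all that the clauses read; all that Bałaban's small-field analyticity supports uniformly in the cutoff).  REV 2 (answer to refuter1 g12
FINDING-27812 (I), misstated: the window clauses read the densities pointwise while consistency + `withDensity` pin them only Haar-a.e., so a
null-set spike was a free class member): continuity pin (the measure determines the representative on the open window), organ stated WITHOUT the
pair-rate `ω` it never used.  REV 1 (answer to idea-crit-5 g3 VERDICT #90): additive LARGE-FIELD FLOOR `δ_j ≥ 0` in the organ; backward Grönwall
chain WITH FORCING concluding a one-bond OSCILLATION bound; termination from a decaying flatness defect; A♯ asks only `liminf J·ω_J = 0`.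

Contents: (1) `backwardChainLemma_holds : BackwardChainLemma` — SORRY-FREE proof of the support item (rev 3 statement); a prover may land it
verbatim as `Theorems/BackwardLiouvilleRigidityBackwardChainLemma.lean`. (2) the BC3 skeleton of the organ (rev 3): `stub_twoComponentStep` (XL),
`stub_potentialForm` (S, provable now: θ = C/(1-λ)+1, C' = C, floor (θ+1)δ), the hypothesised composition `OneStepBackwardContraction_of`
(concluding the alias `OrganGoal`) and the registered by-name composition `oneStepBackwardContraction_of_stubs`.
-/

namespace Summit.QuantumFields.YangMills.Cruxes.OneStepBackwardContraction.BackwardLiouville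

open scoped BigOperators Topology Classical MeasureTheory Matrix
open Filter Set Function TopologicalSpace MeasureTheory
open Summit.QuantumFields.YangMills.Theses.BackwardLiouvilleRigidity

theorem backwardChainLemma_holds : BackwardChainLemma := by
  classical
  intro hC1
  obtain ⟨γ₁, hγ₁, h1⟩ := hC1
  refine ⟨γ₁, hγ₁, fun F γ hγ hle b₀ p₀ κ j₀ prm ω η hκ hpos hη μ μ' ρ ρ' hc hc' hB => ?_⟩
  obtain ⟨θ, C, w₀, ε, δ, j₁, hθ, hC, hw₀, hεδ, hεs, hδs, hDs, hdec, hj₀₁, hstep⟩ :=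
    h1 F γ hγ hle b₀ p₀ κ j₀ prm η hκ (fun j => (hpos j).2) hη μ μ' ρ ρ' hc hc'
      (fun j hj => by obtain ⟨a1, a2, a3, a4, a5, _, a7, a8, a9⟩ := hB j hj; exact ⟨a1, a2, a3, a4, a5, a7, a8, a9⟩)
  refine ⟨θ, C, w₀, ε, δ, j₁, hθ, hC, hw₀, hεδ, hεs, hδs, hDs, hdec, hj₀₁, fun j J hj hJj hsmall hquad b U V hU hV hUV => ?_⟩
  have hε0 : ∀ k, 0 ≤ ε k := fun k => (hεδ k).1
  have hδ0 : ∀ k, 0 ≤ δ k := fun k => (hεδ k).2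
  have hG : 0 < Real.exp (∑' k, ε k + 1) := Real.exp_pos _
  have hωJ : 0 ≤ ω J := (hpos J).1
  have hv0 : 0 ≤ (θ * ω J) := mul_nonneg hθ.le hωJ
  have hDnn : ∀ i : ℕ, 0 ≤ ∑' k, δ (k + i) := fun i => tsum_nonneg fun k => hδ0 _
  have hDsucc : ∀ i : ℕ, ∑' k, δ (k + i) = δ i + ∑' k, δ (k + (i + 1)) := by
    intro i
    have hs : Summable (fun k => δ (k + i)) := (summable_nat_add_iff (f := δ) i).mpr hδs
    rw [hs.tsum_eq_zero_add]
    simp only [zero_add]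
    congr 1
    exact tsum_congr fun k => by rw [show k + 1 + i = k + (i + 1) by omega]
  have hDanti : ∀ i : ℕ, ∑' k, δ (k + (i + 1)) ≤ ∑' k, δ (k + i) := fun i => by
    rw [hDsucc i]; linarith [hδ0 i]
  have hDmono : Antitone (fun i : ℕ => ∑' k, δ (k + i)) := antitone_nat_of_succ_le hDanti
  have hsumD : ∀ i : ℕ, j ≤ i → ∑ n ∈ Finset.Ico i J, (∑' k, δ (k + (n + 1))) ≤ (∑' i, ∑' k, δ (k + (i + j))) := by
    intro i hji
    have hDs' : Summable (fun n => ∑' k, δ (k + (n + j))) := (summable_nat_add_iff (f := fun i => ∑' k, δ (k + i)) j).mpr hDs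
    calc ∑ n ∈ Finset.Ico i J, (∑' k, δ (k + (n + 1)))
        ≤ ∑ k ∈ Finset.Ico i J, ∑' m, δ (m + k) := Finset.sum_le_sum fun k _ => hDanti k
      _ ≤ ∑ k ∈ Finset.Ico j J, ∑' m, δ (m + k) :=
          Finset.sum_le_sum_of_subset_of_nonneg (Finset.Ico_subset_Ico hji le_rfl) fun k _ _ => hDnn k
      _ = ∑ n ∈ Finset.range (J - j), ∑' m, δ (m + (j + n)) := Finset.sum_Ico_eq_sum_range _ _ _
      _ = ∑ n ∈ Finset.range (J - j), ∑' m, δ (m + (n + j)) := by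
          refine Finset.sum_congr rfl fun n _ => ?_
          rw [Nat.add_comm j n]
      _ ≤ (∑' i, ∑' k, δ (k + (i + j))) := hDs'.sum_le_tsum _ fun n _ => hDnn _
  have hsumε : ∀ i : ℕ, ∑ k ∈ Finset.Ico i J, ε k ≤ ∑' k, ε k := fun i => hεs.sum_le_tsum _ fun k _ => hε0 k
  have hEXPO : ∀ i : ℕ, j ≤ i → (∑ k ∈ Finset.Ico i J, ε k + C * (Real.exp (∑' k, ε k + 1) * (((J - i : ℕ) : ℝ) * (θ * ω J) + ∑ n ∈ Finset.Ico i J, (∑' k, δ (k + (n + 1)))))) ≤ ∑' k, ε k + 1 := by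
    intro i hji
    have h1 := hsumε i
    have hJi : ((J - i : ℕ) : ℝ) ≤ (J : ℝ) := by exact_mod_cast Nat.sub_le J i
    have h3 : ((J - i : ℕ) : ℝ) * (θ * ω J) + ∑ n ∈ Finset.Ico i J, (∑' k, δ (k + (n + 1))) ≤ (J : ℝ) * (θ * ω J) + (∑' i, ∑' k, δ (k + (i + j))) :=
      add_le_add (mul_le_mul_of_nonneg_right hJi hv0) (hsumD i hji)
    have h2 : C * (Real.exp (∑' k, ε k + 1) * (((J - i : ℕ) : ℝ) * (θ * ω J) + ∑ n ∈ Finset.Ico i J, (∑' k, δ (k + (n + 1))))) ≤ 1 :=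
      le_trans (mul_le_mul_of_nonneg_left (mul_le_mul_of_nonneg_left h3 hG.le) hC) hquad
    linarith
  have hEXPOnn : ∀ i : ℕ, 0 ≤ (∑ k ∈ Finset.Ico i J, ε k + C * (Real.exp (∑' k, ε k + 1) * (((J - i : ℕ) : ℝ) * (θ * ω J) + ∑ n ∈ Finset.Ico i J, (∑' k, δ (k + (n + 1)))))) := fun i =>
    add_nonneg (Finset.sum_nonneg fun k _ => hε0 k)
      (mul_nonneg hC (mul_nonneg hG.le (add_nonneg (mul_nonneg (Nat.cast_nonneg _) hv0)
        (Finset.sum_nonneg fun n _ => hDnn (n + 1)))))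
  have claim : ∀ n : ℕ, ∀ i : ℕ, i + n = J → j ≤ i → ∃ (c : Literature.MathematicalPhysics.QuantumFieldTheory.Balaban1983to89.Plaq (F.P i) 0 → ℝ) (a w : ℝ), 0 ≤ a ∧ 0 ≤ w ∧ a + θ * w ≤ Real.exp (∑ k ∈ Finset.Ico i J, ε k + C * (Real.exp (∑' k, ε k + 1) * (((J - i : ℕ) : ℝ) * (θ * ω J) + ∑ n ∈ Finset.Ico i J, (∑' k, δ (k + (n + 1)))))) * ((θ * ω J) + (∑' k, δ (k + i))) ∧ ((∀ p, |c p| ≤ a) ∧ (∀ (b b' : Literature.MathematicalPhysics.QuantumFieldTheory.Balaban1983to89.PBond (F.P i) 0) U V W Z, Literature.MathematicalPhysics.QuantumFieldTheory.Balaban1983to89.PlaqSmall (Literature.MathematicalPhysics.QuantumFieldTheory.Balaban1983to89.T3UnitScaleTilt.θBal F.L γ b₀ p₀ i) U → Literature.MathematicalPhysics.QuantumFieldTheory.Balaban1983to89.PlaqSmall (Literature.MathematicalPhysics.QuantumFieldTheory.Balaban1983to89.T3UnitScaleTilt.θBal F.L γ b₀ p₀ i) V → Literature.MathematicalPhysics.QuantumFieldTheory.Balaban1983to89.PlaqSmall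 (Literature.MathematicalPhysics.QuantumFieldTheory.Balaban1983to89.T3UnitScaleTilt.θBal F.L γ b₀ p₀ i) W → Literature.MathematicalPhysics.QuantumFieldTheory.Balaban1983to89.PlaqSmall (Literature.MathematicalPhysics.QuantumFieldTheory.Balaban1983to89.T3UnitScaleTilt.θBal F.L γ b₀ p₀ i) Z → (∀ e, e ≠ b → U e = V e) → (∀ e, e ≠ b' → U e = W e) → (∀ e, e ≠ b' → V e = Z e) → (∀ e, e ≠ b → W e = Z e) → |(Real.log (ρ i U) - Real.log (ρ' i U) - ((F.L : ℝ) ^ i / γ) * ∑ p, c p * (1 - Literature.MathematicalPhysics.QuantumFieldTheory.Balaban1983to89.reTr (Literature.MathematicalPhysics.QuantumFieldTheory.Balaban1983to89.GaugeField.plaqHol U p))) - (Real.log (ρ i V) - Real.log (ρ' i V) - ((F.L : ℝ) ^ i / γ) * ∑ p, c p * (1 - Literature.MathematicalPhysics.QuantumFieldTheory.Balaban1983to89.reTr (Literature.MathematicalPhysics.QuantumFieldTheory.Balaban1983to89.GaugeField.plaqHol V p))) - ((Real.log (ρ i W) - Real.log (ρ' i W) - ((F.L : ℝ) ^ i / γ)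 * ∑ p, c p * (1 - Literature.MathematicalPhysics.QuantumFieldTheory.Balaban1983to89.reTr (Literature.MathematicalPhysics.QuantumFieldTheory.Balaban1983to89.GaugeField.plaqHol W p))) - (Real.log (ρ i Z) - Real.log (ρ' i Z) - ((F.L : ℝ) ^ i / γ) * ∑ p, c p * (1 - Literature.MathematicalPhysics.QuantumFieldTheory.Balaban1983to89.reTr (Literature.MathematicalPhysics.QuantumFieldTheory.Balaban1983to89.GaugeField.plaqHol Z p))))| ≤ w * Real.exp (-(κ * (b.src.tdist b'.src : ℝ))))) := by
    intro n
    induction n with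
    | zero =>
      intro i hi hji
      obtain ⟨gposS, gμ, gμ', gmem, gmem', gosc2, gtl, gtl', gcont⟩ := hB i (by omega)
      have hiJ : J = i := by omega
      refine ⟨fun _ => 0, 0, ω i, le_rfl, (hpos i).1, ?_, ?_, ?_⟩
      · rw [zero_add]
        calc θ * ω i = 1 * (θ * ω i) := (one_mul _).symm
          _ ≤ Real.exp (∑ k ∈ Finset.Ico i J, ε k + C * (Real.exp (∑' k, ε k + 1) * (((J - i : ℕ) : ℝ) * (θ * ω J) + ∑ n ∈ Finset.Ico i J, (∑' k, δ (k + (n + 1)))))) * ((θ * ω J) + (∑' k, δ (k + i))) :=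
            mul_le_mul (Real.one_le_exp (hEXPOnn i)) (by rw [hiJ]; linarith [hDnn i])
              (mul_nonneg hθ.le (hpos i).1) (Real.exp_pos _).le
      · intro p; simp
      · intro b b' U V W Z hU hV hW hZ h1 h2 h3 h4
        simp only [zero_mul, Finset.sum_const_zero, mul_zero, sub_zero]
        exact gosc2 b b' U V W Z hU hV hW hZ h1 h2 h3 h4
    | succ n ih =>
      intro i hi hji
      have hiJ : i < J := by omega
      have hj1i : j₁ ≤ i := le_trans hj hji
      obtain ⟨c, a, w, ha, hw, hVb, hadm⟩ := ih (i + 1) (by omega) (by omega)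
      have hVnn : 0 ≤ a + θ * w := add_nonneg ha (mul_nonneg hθ.le hw)
      have hx1 : 0 ≤ (θ * ω J) + (∑' k, δ (k + (i + 1))) := add_nonneg hv0 (hDnn _)
      have hB1 : a + θ * w ≤ Real.exp (∑' k, ε k + 1) * ((θ * ω J) + (∑' k, δ (k + (i + 1)))) :=
        hVb.trans (mul_le_mul_of_nonneg_right (Real.exp_le_exp.mpr (hEXPO (i + 1) (by omega))) hx1)
      have hside : a + θ * w ≤ w₀ := by
        have hD' : (∑' k, δ (k + (i + 1))) ≤ (∑' k, δ (k + j)) := hDmono (show j ≤ i + 1 by omega)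
        have : Real.exp (∑' k, ε k + 1) * ((θ * ω J) + (∑' k, δ (k + (i + 1)))) ≤ Real.exp (∑' k, ε k + 1) * (θ * ω J + (∑' k, δ (k + j))) := mul_le_mul_of_nonneg_left (by linarith) hG.le
        exact hB1.trans (this.trans hsmall)
      obtain ⟨c', a', w', ha', hw', hV', hadm'⟩ := hstep i hj1i c a w ha hw hside hadm
      refine ⟨c', a', w', ha', hw', ?_, hadm'⟩
      have hfac : 1 + ε i + C * (a + θ * w) ≤ Real.exp (ε i + C * (Real.exp (∑' k, ε k + 1) * ((θ * ω J) + (∑' k, δ (k + (i + 1)))))) := by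
        have h1 : C * (a + θ * w) ≤ C * (Real.exp (∑' k, ε k + 1) * ((θ * ω J) + (∑' k, δ (k + (i + 1))))) := mul_le_mul_of_nonneg_left hB1 hC
        have h2 := Real.add_one_le_exp (ε i + C * (Real.exp (∑' k, ε k + 1) * ((θ * ω J) + (∑' k, δ (k + (i + 1))))))
        linarith
      have hprod : 1 ≤ Real.exp (ε i + C * (Real.exp (∑' k, ε k + 1) * ((θ * ω J) + (∑' k, δ (k + (i + 1)))))) * Real.exp (∑ k ∈ Finset.Ico (i + 1) J, ε k + C * (Real.exp (∑' k, ε k + 1) * (((J - (i + 1) : ℕ) : ℝ) * (θ * ω J) + ∑ n ∈ Finset.Ico (i + 1) J, (∑' k, δ (k + (n + 1)))))) := by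
        rw [← Real.exp_add]
        exact Real.one_le_exp (add_nonneg (add_nonneg (hε0 i) (mul_nonneg hC (mul_nonneg hG.le hx1))) (hEXPOnn (i + 1)))
      have hIcoε : ∑ k ∈ Finset.Ico i J, ε k = ε i + ∑ k ∈ Finset.Ico (i + 1) J, ε k :=
        Finset.sum_eq_sum_Ico_succ_bot hiJ _
      have hIcoD : ∑ n ∈ Finset.Ico i J, (∑' k, δ (k + (n + 1))) = (∑' k, δ (k + (i + 1))) + ∑ n ∈ Finset.Ico (i + 1) J, (∑' k, δ (k + (n + 1))) :=
        Finset.sum_eq_sum_Ico_succ_bot hiJ (fun n => (∑' k, δ (k + (n + 1))))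
      have hsub : ((J - i : ℕ) : ℝ) = ((J - (i + 1) : ℕ) : ℝ) + 1 := by
        have : (J - i : ℕ) = (J - (i + 1)) + 1 := by omega
        rw [this]; push_cast; ring
      have hE : (ε i + C * (Real.exp (∑' k, ε k + 1) * ((θ * ω J) + (∑' k, δ (k + (i + 1)))))) + (∑ k ∈ Finset.Ico (i + 1) J, ε k + C * (Real.exp (∑' k, ε k + 1) * (((J - (i + 1) : ℕ) : ℝ) * (θ * ω J) + ∑ n ∈ Finset.Ico (i + 1) J, (∑' k, δ (k + (n + 1)))))) = (∑ k ∈ Finset.Ico i J, ε k + C * (Real.exp (∑' k, ε k + 1) * (((J - i : ℕ) : ℝ) * (θ * ω J) + ∑ n ∈ Finset.Ico i J, (∑' k, δ (k + (n + 1)))))) := by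
        rw [hIcoε, hIcoD, hsub]; ring
      calc a' + θ * w' ≤ (1 + ε i + C * (a + θ * w)) * (a + θ * w) + δ i := hV'
        _ ≤ Real.exp (ε i + C * (Real.exp (∑' k, ε k + 1) * ((θ * ω J) + (∑' k, δ (k + (i + 1)))))) * (Real.exp (∑ k ∈ Finset.Ico (i + 1) J, ε k + C * (Real.exp (∑' k, ε k + 1) * (((J - (i + 1) : ℕ) : ℝ) * (θ * ω J) + ∑ n ∈ Finset.Ico (i + 1) J, (∑' k, δ (k + (n + 1)))))) * ((θ * ω J) + (∑' k, δ (k + (i + 1))))) + δ i := by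
            have := mul_le_mul hfac hVb hVnn (Real.exp_pos _).le
            linarith
        _ ≤ Real.exp (ε i + C * (Real.exp (∑' k, ε k + 1) * ((θ * ω J) + (∑' k, δ (k + (i + 1)))))) * Real.exp (∑ k ∈ Finset.Ico (i + 1) J, ε k + C * (Real.exp (∑' k, ε k + 1) * (((J - (i + 1) : ℕ) : ℝ) * (θ * ω J) + ∑ n ∈ Finset.Ico (i + 1) J, (∑' k, δ (k + (n + 1)))))) * ((θ * ω J) + (∑' k, δ (k + (i + 1))) + δ i) := by
            have hδ' : δ i ≤ Real.exp (ε i + C * (Real.exp (∑' k, ε k + 1) * ((θ * ω J) + (∑' k, δ (k + (i + 1)))))) * Real.exp (∑ k ∈ Finset.Ico (i + 1) J, ε k + C * (Real.exp (∑' k, ε k + 1) * (((J - (i + 1) : ℕ) : ℝ) * (θ * ω J) + ∑ n ∈ Finset.Ico (i + 1) J, (∑' k, δ (k + (n + 1)))))) * δ i := le_mul_of_one_le_left (hδ0 i) hprod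
            have hring : Real.exp (ε i + C * (Real.exp (∑' k, ε k + 1) * ((θ * ω J) + (∑' k, δ (k + (i + 1)))))) * (Real.exp (∑ k ∈ Finset.Ico (i + 1) J, ε k + C * (Real.exp (∑' k, ε k + 1) * (((J - (i + 1) : ℕ) : ℝ) * (θ * ω J) + ∑ n ∈ Finset.Ico (i + 1) J, (∑' k, δ (k + (n + 1)))))) * ((θ * ω J) + (∑' k, δ (k + (i + 1))))) + δ i
                = Real.exp (ε i + C * (Real.exp (∑' k, ε k + 1) * ((θ * ω J) + (∑' k, δ (k + (i + 1)))))) * Real.exp (∑ k ∈ Finset.Ico (i + 1) J, ε k + C * (Real.exp (∑' k, ε k + 1) * (((J - (i + 1) : ℕ) : ℝ) * (θ * ω J) + ∑ n ∈ Finset.Ico (i + 1) J, (∑' k, δ (k + (n + 1)))))) * ((θ * ω J) + (∑' k, δ (k + (i + 1))) + δ i)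
                  - (Real.exp (ε i + C * (Real.exp (∑' k, ε k + 1) * ((θ * ω J) + (∑' k, δ (k + (i + 1)))))) * Real.exp (∑ k ∈ Finset.Ico (i + 1) J, ε k + C * (Real.exp (∑' k, ε k + 1) * (((J - (i + 1) : ℕ) : ℝ) * (θ * ω J) + ∑ n ∈ Finset.Ico (i + 1) J, (∑' k, δ (k + (n + 1)))))) * δ i - δ i) := by ring
            rw [hring]; linarith [hδ']
        _ = Real.exp (∑ k ∈ Finset.Ico i J, ε k + C * (Real.exp (∑' k, ε k + 1) * (((J - i : ℕ) : ℝ) * (θ * ω J) + ∑ n ∈ Finset.Ico i J, (∑' k, δ (k + (n + 1)))))) * ((θ * ω J) + (∑' k, δ (k + i))) := by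
            rw [← Real.exp_add, hE, hDsucc i]; ring
  obtain ⟨c, a, w, ha, hw, hVb, hcB, hadm2⟩ := claim (J - j) j (by omega) le_rfl
  have hXnn : 0 ≤ Real.exp (∑' k, ε k + 1) * (θ * ω J + (∑' k, δ (k + j))) := mul_nonneg hG.le (add_nonneg hv0 (hDnn j))
  have hBf : a + θ * w ≤ Real.exp (∑' k, ε k + 1) * (θ * ω J + (∑' k, δ (k + j))) :=
    hVb.trans (mul_le_mul_of_nonneg_right (Real.exp_le_exp.mpr (hEXPO j le_rfl)) (add_nonneg hv0 (hDnn j)))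
  have hwB : w ≤ Real.exp (∑' k, ε k + 1) * (θ * ω J + (∑' k, δ (k + j))) / θ := by
    rw [le_div_iff₀ hθ]
    calc w * θ = θ * w := mul_comm _ _
      _ ≤ a + θ * w := le_add_of_nonneg_left ha
      _ ≤ Real.exp (∑' k, ε k + 1) * (θ * ω J + (∑' k, δ (k + j))) := hBf
  have haB : a ≤ Real.exp (∑' k, ε k + 1) * (θ * ω J + (∑' k, δ (k + j))) := le_trans (le_add_of_nonneg_right (mul_nonneg hθ.le hw)) hBf
  have htr : ∀ g : ↥(Matrix.specialUnitaryGroup (Fin 2) ℂ), |Literature.MathematicalPhysics.QuantumFieldTheory.Balaban1983to89.reTr g| ≤ 1 := fun g =>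
    Literature.MathematicalPhysics.QuantumFieldTheory.Balaban1983to89.RegularGaugeGroup.abs_reTr_le_one g
  have hmarg : ∀ (ι : Type) [Fintype ι] (c f g : ι → ℝ) (a : ℝ), 0 ≤ a → (∀ p, |c p| ≤ a) → (∀ p, |f p| ≤ 1) →
      (∀ p, |g p| ≤ 1) → |(∑ p, c p * (1 - f p)) - (∑ p, c p * (1 - g p))| ≤ (Fintype.card ι : ℝ) * (a * 2) := by
    intro ι _ c f g a ha hcB hf hg
    rw [← Finset.sum_sub_distrib]
    refine (Finset.abs_sum_le_sum_abs _ _).trans ?_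
    have hterm : ∀ p ∈ (Finset.univ : Finset ι), |c p * (1 - f p) - c p * (1 - g p)| ≤ a * 2 := by
      intro p _
      rw [← mul_sub, abs_mul]
      have h1 := hf p
      have h2 := hg p
      have hdiff : |(1 - f p) - (1 - g p)| ≤ 2 := by
        rw [abs_le] at h1 h2 ⊢; constructor <;> linarith [h1.1, h1.2, h2.1, h2.2]
      exact mul_le_mul (hcB p) hdiff (abs_nonneg _) ha
    refine (Finset.sum_le_sum hterm).trans ?_
    rw [Finset.sum_const, Finset.card_univ, nsmul_eq_mul]
  have hβ : 0 ≤ ((F.L : ℝ) ^ j / γ) := by positivity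
  have hNp : 0 ≤ (Fintype.card (Literature.MathematicalPhysics.QuantumFieldTheory.Balaban1983to89.Plaq (F.P j) 0) : ℝ) := by positivity
  have hq : Real.exp (-(κ * (b.src.tdist b.src : ℝ))) ≤ 1 :=
    Real.exp_le_one_iff.mpr (neg_nonpos.mpr (mul_nonneg hκ.le (Nat.cast_nonneg _)))
  have fin : ∀ (x y su sv q : ℝ), q ≤ 1 → |x - ((F.L : ℝ) ^ j / γ) * su - (y - ((F.L : ℝ) ^ j / γ) * sv) - ((x - ((F.L : ℝ) ^ j / γ) * su) - (x - ((F.L : ℝ) ^ j / γ) * su))| ≤ w * q →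
      |su - sv| ≤ (Fintype.card (Literature.MathematicalPhysics.QuantumFieldTheory.Balaban1983to89.Plaq (F.P j) 0) : ℝ) * (a * 2) → |x - y| ≤ Real.exp (∑' k, ε k + 1) * (θ * ω J + (∑' k, δ (k + j))) * (1 / θ + 2 * ((F.L : ℝ) ^ j / γ) * (Fintype.card (Literature.MathematicalPhysics.QuantumFieldTheory.Balaban1983to89.Plaq (F.P j) 0) : ℝ)) := by
    intro x y su sv q hq1 hxy0 hs
    have hxy : |x - ((F.L : ℝ) ^ j / γ) * su - (y - ((F.L : ℝ) ^ j / γ) * sv)| ≤ w := by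
      rw [sub_self, sub_zero] at hxy0
      exact hxy0.trans (mul_le_of_le_one_right hw hq1)
    have e : x - y = (x - ((F.L : ℝ) ^ j / γ) * su - (y - ((F.L : ℝ) ^ j / γ) * sv)) + ((F.L : ℝ) ^ j / γ) * (su - sv) := by ring
    rw [e]
    refine (abs_add_le _ _).trans ?_
    rw [abs_mul, abs_of_nonneg hβ]
    have ha2 : a * 2 ≤ Real.exp (∑' k, ε k + 1) * (θ * ω J + (∑' k, δ (k + j))) * 2 := by linarith
    calc |x - ((F.L : ℝ) ^ j / γ) * su - (y - ((F.L : ℝ) ^ j / γ) * sv)| + ((F.L : ℝ) ^ j / γ) * |su - sv|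
        ≤ w + ((F.L : ℝ) ^ j / γ) * ((Fintype.card (Literature.MathematicalPhysics.QuantumFieldTheory.Balaban1983to89.Plaq (F.P j) 0) : ℝ) * (a * 2)) := add_le_add hxy (mul_le_mul_of_nonneg_left hs hβ)
      _ ≤ Real.exp (∑' k, ε k + 1) * (θ * ω J + (∑' k, δ (k + j))) / θ + ((F.L : ℝ) ^ j / γ) * ((Fintype.card (Literature.MathematicalPhysics.QuantumFieldTheory.Balaban1983to89.Plaq (F.P j) 0) : ℝ) * (Real.exp (∑' k, ε k + 1) * (θ * ω J + (∑' k, δ (k + j))) * 2)) :=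
          add_le_add hwB (mul_le_mul_of_nonneg_left (mul_le_mul_of_nonneg_left ha2 hNp) hβ)
      _ = Real.exp (∑' k, ε k + 1) * (θ * ω J + (∑' k, δ (k + j))) * (1 / θ + 2 * ((F.L : ℝ) ^ j / γ) * (Fintype.card (Literature.MathematicalPhysics.QuantumFieldTheory.Balaban1983to89.Plaq (F.P j) 0) : ℝ)) := by ring
  exact fin _ _ _ _ _ hq
    (hadm2 b b U V U U hU hV hU hU hUV (fun e _ => rfl) (fun e he => (hUV e he).symm) (fun e _ => rfl))
    (hmarg _ c (fun p => Literature.MathematicalPhysics.QuantumFieldTheory.Balaban1983to89.reTr (Literature.MathematicalPhysics.QuantumFieldTheory.Balaban1983to89.GaugeField.plaqHol U p)) (fun p => Literature.MathematicalPhysics.QuantumFieldTheory.Balaban1983to89.reTr (Literature.MathematicalPhysics.QuantumFieldTheory.Balaban1983to89.GaugeField.plaqHol V p)) a ha hcB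
      (fun p => htr _) (fun p => htr _))

/-! ## BC3 skeleton of the organ `OneStepBackwardContraction` (rev 3: large-field floor `δ_j`, densities continuous on the window, no pair-rate hypothesis)
Two registered stubs and the kernel-checked composition `OneStepBackwardContraction_of`.
* `stub_twoComponentStep` (XL, the analytic content): Bałaban's small-field inductive step run for the DIFFERENCE of two class
  trajectories gives the TWO-COMPONENT bound — marginal profile `a' ≤ (1+ε_j)a + C w + C a² + δ_j` and clustered remainder
  `w' ≤ λ w + ε_j a + C (a+w) w + δ_j` with `λ < 1` (power count of the leading irrelevant gauge-invariant local term, degree 6: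
  `λ_3 = L^(-3/2)`), where the FLOOR `δ_j ≥ 0` is the large-field leakage of one renormalisation step (mass of the complement of the
  window in a fibre of `descend`, `≲ e^(-c·p(g_(j+1))²)·#T_(j+1)`, super-polynomially small in `L^j`): summable, with summable tails,
  and `(Σ_(k≥j) δ_k)·(1 + 2 L^j/γ·#Plaq_j)·#PBond_j² → 0` (the decay the termination step consumes).
* `stub_potentialForm` (S, pure real algebra): any such two-component bound is a one-potential bound for `V = a + θ w` with
  `θ = C/(1-λ) + 1`, `C' = C`, `ε' = (θ+1) ε`, floor `(θ+1) δ` — the normal form filed as the crux.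
-/

/-- stub (XL): the two-component one-step bound (with large-field floor) for differences of class trajectories. -/
theorem stub_twoComponentStep :
    open MeasureTheory Filter Topology Literature.MathematicalPhysics.QuantumFieldTheory.Balaban1983to89 T3ContinuumYM3Torus T3NestedUnitLaws T3UnitLawDensityEML BalabanUVClass T3UnitScaleTilt in ∃ γ₁ : ℝ, 0 < γ₁ ∧ ∀ (F : T3Family) (γ : ℝ), 0 < γ → γ ≤ γ₁ → ∀ (b₀ p₀ κ : ℝ) (j₀ : ℕ) (prm : ℕ → ClassParams) (η : ℕ → ℝ), 0 < κ → (∀ j, 0 ≤ η j) → Summable η → ∀ (μ μ' : ((j : ℕ) → MeasureTheory.Measure (GaugeField (F.P j) 0 ↥(Matrix.specialUnitaryGroup (Fin 2) ℂ)))) (ρ ρ' : ((j : ℕ) → GaugeField (F.P j) 0 ↥(Matrix.specialUnitaryGroup (Fin 2) ℂ) → ℝ)), (∀ j : ℕ, IsProbabilityMeasure (μ j) ∧ μ j = Measure.map (descend F ℰp j) (μ (j + 1))) → (∀ j : ℕ, IsProbabilityMeasure (μ' j) ∧ μ' j = Measure.map (descend F ℰp j) (μ' (j + 1))) → (∀ j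 : ℕ, j₀ ≤ j → ((∀ U, PlaqSmall (θBal F.L γ b₀ p₀ j) U → 0 < ρ j U ∧ 0 < ρ' j U) ∧ μ j = (fieldMeasure _ _ _).withDensity (fun U => ENNReal.ofReal (ρ j U)) ∧ μ' j = (fieldMeasure _ _ _).withDensity (fun U => ENNReal.ofReal (ρ' j U)) ∧ MemAtHeight F ℰp j (prm j) (ρ j) ∧ MemAtHeight F ℰp j (prm j) (ρ' j) ∧ μ j {U | ¬ PlaqSmall (θBal F.L γ b₀ p₀ j) U} ≤ ENNReal.ofReal (η j) ∧ μ' j {U | ¬ PlaqSmall (θBal F.L γ b₀ p₀ j) U} ≤ ENNReal.ofReal (η j) ∧ (ContinuousOn (ρ j) {U | PlaqSmall (θBal F.L γ b₀ p₀ j) U} ∧ ContinuousOn (ρ' j) {U | PlaqSmall (θBal F.L γ b₀ p₀ j) U}))) → ∃ (l C w₀ : ℝ) (ε δ : ℕ → ℝ) (j₁ : ℕ), 0 ≤ l ∧ l < 1 ∧ 0 ≤ C ∧ 0 < w₀ ∧ (∀ j, 0 ≤ ε j ∧ 0 ≤ δ j) ∧ Summable ε ∧ Summable δ ∧ Summable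 (fun i => ∑' k, δ (k + i)) ∧ Tendsto (fun j => (∑' k, δ (k + j)) * ((1 + 2 * ((F.L : ℝ) ^ j / γ) * (Fintype.card (Plaq (F.P j) 0) : ℝ)) * (Fintype.card (PBond (F.P j) 0) : ℝ) ^ 2)) atTop (𝓝 0) ∧ j₀ ≤ j₁ ∧ ∀ j ≥ j₁, ∀ (c : Plaq (F.P (j + 1)) 0 → ℝ) a w, 0 ≤ a → 0 ≤ w → a + w ≤ w₀ → ((∀ p, |c p| ≤ a) ∧ (∀ (b b' : PBond (F.P (j + 1)) 0) U V W Z, PlaqSmall (θBal F.L γ b₀ p₀ (j + 1)) U → PlaqSmall (θBal F.L γ b₀ p₀ (j + 1)) V → PlaqSmall (θBal F.L γ b₀ p₀ (j + 1)) W → PlaqSmall (θBal F.L γ b₀ p₀ (j + 1)) Z → (∀ e, e ≠ b → U e = V e) → (∀ e, e ≠ b' → U e = W e) → (∀ e, e ≠ b' → V e = Z e) → (∀ e, e ≠ b → W e = Z e) → |(Real.log (ρ (j + 1) U) - Real.log (ρ' (j + 1) U) - ((F.L : ℝ) ^ (j + 1) / γ) * ∑ p, c p * (1 - reTr (GaugeField.plaqHol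 U p))) - (Real.log (ρ (j + 1) V) - Real.log (ρ' (j + 1) V) - ((F.L : ℝ) ^ (j + 1) / γ) * ∑ p, c p * (1 - reTr (GaugeField.plaqHol V p))) - ((Real.log (ρ (j + 1) W) - Real.log (ρ' (j + 1) W) - ((F.L : ℝ) ^ (j + 1) / γ) * ∑ p, c p * (1 - reTr (GaugeField.plaqHol W p))) - (Real.log (ρ (j + 1) Z) - Real.log (ρ' (j + 1) Z) - ((F.L : ℝ) ^ (j + 1) / γ) * ∑ p, c p * (1 - reTr (GaugeField.plaqHol Z p))))| ≤ w * Real.exp (-(κ * (b.src.tdist b'.src : ℝ))))) → ∃ (c' : Plaq (F.P j) 0 → ℝ) (a' w' : ℝ), 0 ≤ a' ∧ 0 ≤ w' ∧ a' ≤ (1 + ε j) * a + C * w + C * a ^ 2 + δ j ∧ w' ≤ l * w + ε j * a + C * (a + w) * w + δ j ∧ ((∀ p, |c' p| ≤ a') ∧ (∀ (b b' : PBond (F.P j) 0) U V W Z, PlaqSmall (θBal F.L γ b₀ p₀ j) U → PlaqSmall (θBal F.L γ b₀ p₀ j) V → PlaqSmall (θBal F.L γ b₀ p₀ j) W → PlaqSmall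 (θBal F.L γ b₀ p₀ j) Z → (∀ e, e ≠ b → U e = V e) → (∀ e, e ≠ b' → U e = W e) → (∀ e, e ≠ b' → V e = Z e) → (∀ e, e ≠ b → W e = Z e) → |(Real.log (ρ j U) - Real.log (ρ' j U) - ((F.L : ℝ) ^ j / γ) * ∑ p, c' p * (1 - reTr (GaugeField.plaqHol U p))) - (Real.log (ρ j V) - Real.log (ρ' j V) - ((F.L : ℝ) ^ j / γ) * ∑ p, c' p * (1 - reTr (GaugeField.plaqHol V p))) - ((Real.log (ρ j W) - Real.log (ρ' j W) - ((F.L : ℝ) ^ j / γ) * ∑ p, c' p * (1 - reTr (GaugeField.plaqHol W p))) - (Real.log (ρ j Z) - Real.log (ρ' j Z) - ((F.L : ℝ) ^ j / γ) * ∑ p, c' p * (1 - reTr (GaugeField.plaqHol Z p))))| ≤ w' * Real.exp (-(κ * (b.src.tdist b'.src : ℝ))))) := by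
  sorry

/-- stub (S): two-component bounds with `λ < 1` and a floor fold into the potential form. -/
theorem stub_potentialForm :
    ∀ (lam C : ℝ), 0 ≤ lam → lam < 1 → 0 ≤ C → ∃ θ C' : ℝ, 1 ≤ θ ∧ 0 ≤ C' ∧ ∀ (e d a w a' w' : ℝ), 0 ≤ e → 0 ≤ d → 0 ≤ a → 0 ≤ w → 0 ≤ a' → 0 ≤ w' → a' ≤ (1 + e) * a + C * w + C * a ^ 2 + d → w' ≤ lam * w + e * a + C * (a + w) * w + d → a' + θ * w' ≤ (1 + (θ + 1) * e + C' * (a + θ * w)) * (a + θ * w) + (θ + 1) * d := by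
  sorry

/-- Local reducible alias of the crux, used ONLY as the conclusion of the hypothesised composition `OneStepBackwardContraction_of`,
so that the registrar `#h21_check_skeleton` (which admits only by-name obligations as hypotheses and takes the first theorem whose
conclusion head IS the crux constant) deterministically selects `oneStepBackwardContraction_of_stubs`. -/
abbrev OrganGoal : Prop := OneStepBackwardContraction

/-- BC3 composition: the two stubs give the organ exactly as filed (rev 3); concluded as the reducible alias `OrganGoal`. -/
theorem OneStepBackwardContraction_of
    (h2 : open MeasureTheory Filter Topology Literature.MathematicalPhysics.QuantumFieldTheory.Balaban1983to89 T3ContinuumYM3Torus T3NestedUnitLaws T3UnitLawDensityEML BalabanUVClass T3UnitScaleTilt in ∃ γ₁ : ℝ, 0 < γ₁ ∧ ∀ (F : T3Family) (γ : ℝ), 0 < γ → γ ≤ γ₁ → ∀ (b₀ p₀ κ : ℝ) (j₀ : ℕ) (prm : ℕ → ClassParams) (η : ℕ → ℝ), 0 < κ → (∀ j, 0 ≤ η j) → Summable η → ∀ (μ μ' : ((j : ℕ) → MeasureTheory.Measure (GaugeField (F.P j) 0 ↥(Matrix.specialUnitaryGroup (Fin 2) ℂ)))) (ρ ρ' : ((j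 : ℕ) → GaugeField (F.P j) 0 ↥(Matrix.specialUnitaryGroup (Fin 2) ℂ) → ℝ)), (∀ j : ℕ, IsProbabilityMeasure (μ j) ∧ μ j = Measure.map (descend F ℰp j) (μ (j + 1))) → (∀ j : ℕ, IsProbabilityMeasure (μ' j) ∧ μ' j = Measure.map (descend F ℰp j) (μ' (j + 1))) → (∀ j : ℕ, j₀ ≤ j → ((∀ U, PlaqSmall (θBal F.L γ b₀ p₀ j) U → 0 < ρ j U ∧ 0 < ρ' j U) ∧ μ j = (fieldMeasure _ _ _).withDensity (fun U => ENNReal.ofReal (ρ j U)) ∧ μ' j = (fieldMeasure _ _ _).withDensity (fun U => ENNReal.ofReal (ρ' j U)) ∧ MemAtHeight F ℰp j (prm j) (ρ j) ∧ MemAtHeight F ℰp j (prm j) (ρ' j) ∧ μ j {U | ¬ PlaqSmall (θBal F.L γ b₀ p₀ j) U} ≤ ENNReal.ofReal (η j) ∧ μ' j {U | ¬ PlaqSmall (θBal F.L γ b₀ p₀ j) U} ≤ ENNReal.ofReal (η j) ∧ (ContinuousOn (ρ j) {U | PlaqSmall (θBal F.L γ b₀ p₀ j) U} ∧ ContinuousOn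 (ρ' j) {U | PlaqSmall (θBal F.L γ b₀ p₀ j) U}))) → ∃ (l C w₀ : ℝ) (ε δ : ℕ → ℝ) (j₁ : ℕ), 0 ≤ l ∧ l < 1 ∧ 0 ≤ C ∧ 0 < w₀ ∧ (∀ j, 0 ≤ ε j ∧ 0 ≤ δ j) ∧ Summable ε ∧ Summable δ ∧ Summable (fun i => ∑' k, δ (k + i)) ∧ Tendsto (fun j => (∑' k, δ (k + j)) * ((1 + 2 * ((F.L : ℝ) ^ j / γ) * (Fintype.card (Plaq (F.P j) 0) : ℝ)) * (Fintype.card (PBond (F.P j) 0) : ℝ) ^ 2)) atTop (𝓝 0) ∧ j₀ ≤ j₁ ∧ ∀ j ≥ j₁, ∀ (c : Plaq (F.P (j + 1)) 0 → ℝ) a w, 0 ≤ a → 0 ≤ w → a + w ≤ w₀ → ((∀ p, |c p| ≤ a) ∧ (∀ (b b' : PBond (F.P (j + 1)) 0) U V W Z, PlaqSmall (θBal F.L γ b₀ p₀ (j + 1)) U → PlaqSmall (θBal F.L γ b₀ p₀ (j + 1)) V → PlaqSmall (θBal F.L γ b₀ p₀ (j + 1)) W → PlaqSmall (θBal F.L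 γ b₀ p₀ (j + 1)) Z → (∀ e, e ≠ b → U e = V e) → (∀ e, e ≠ b' → U e = W e) → (∀ e, e ≠ b' → V e = Z e) → (∀ e, e ≠ b → W e = Z e) → |(Real.log (ρ (j + 1) U) - Real.log (ρ' (j + 1) U) - ((F.L : ℝ) ^ (j + 1) / γ) * ∑ p, c p * (1 - reTr (GaugeField.plaqHol U p))) - (Real.log (ρ (j + 1) V) - Real.log (ρ' (j + 1) V) - ((F.L : ℝ) ^ (j + 1) / γ) * ∑ p, c p * (1 - reTr (GaugeField.plaqHol V p))) - ((Real.log (ρ (j + 1) W) - Real.log (ρ' (j + 1) W) - ((F.L : ℝ) ^ (j + 1) / γ) * ∑ p, c p * (1 - reTr (GaugeField.plaqHol W p))) - (Real.log (ρ (j + 1) Z) - Real.log (ρ' (j + 1) Z) - ((F.L : ℝ) ^ (j + 1) / γ) * ∑ p, c p * (1 - reTr (GaugeField.plaqHol Z p))))| ≤ w * Real.exp (-(κ * (b.src.tdist b'.src : ℝ))))) → ∃ (c' : Plaq (F.P j) 0 → ℝ) (a' w' : ℝ), 0 ≤ a' ∧ 0 ≤ w' ∧ a' ≤ (1 + ε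 j) * a + C * w + C * a ^ 2 + δ j ∧ w' ≤ l * w + ε j * a + C * (a + w) * w + δ j ∧ ((∀ p, |c' p| ≤ a') ∧ (∀ (b b' : PBond (F.P j) 0) U V W Z, PlaqSmall (θBal F.L γ b₀ p₀ j) U → PlaqSmall (θBal F.L γ b₀ p₀ j) V → PlaqSmall (θBal F.L γ b₀ p₀ j) W → PlaqSmall (θBal F.L γ b₀ p₀ j) Z → (∀ e, e ≠ b → U e = V e) → (∀ e, e ≠ b' → U e = W e) → (∀ e, e ≠ b' → V e = Z e) → (∀ e, e ≠ b → W e = Z e) → |(Real.log (ρ j U) - Real.log (ρ' j U) - ((F.L : ℝ) ^ j / γ) * ∑ p, c' p * (1 - reTr (GaugeField.plaqHol U p))) - (Real.log (ρ j V) - Real.log (ρ' j V) - ((F.L : ℝ) ^ j / γ) * ∑ p, c' p * (1 - reTr (GaugeField.plaqHol V p))) - ((Real.log (ρ j W) - Real.log (ρ' j W) - ((F.L : ℝ) ^ j / γ) * ∑ p, c' p * (1 - reTr (GaugeField.plaqHol W p))) - (Real.log (ρ j Z) - Real.log (ρ' j Z) - ((F.L : ℝ) ^ j / γ) * ∑ p,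 c' p * (1 - reTr (GaugeField.plaqHol Z p))))| ≤ w' * Real.exp (-(κ * (b.src.tdist b'.src : ℝ))))))
    (hP : ∀ (lam C : ℝ), 0 ≤ lam → lam < 1 → 0 ≤ C → ∃ θ C' : ℝ, 1 ≤ θ ∧ 0 ≤ C' ∧ ∀ (e d a w a' w' : ℝ), 0 ≤ e → 0 ≤ d → 0 ≤ a → 0 ≤ w → 0 ≤ a' → 0 ≤ w' → a' ≤ (1 + e) * a + C * w + C * a ^ 2 + d → w' ≤ lam * w + e * a + C * (a + w) * w + d → a' + θ * w' ≤ (1 + (θ + 1) * e + C' * (a + θ * w)) * (a + θ * w) + (θ + 1) * d) :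
    OrganGoal := by
  classical
  obtain ⟨γ₁, hγ₁, h⟩ := h2
  refine ⟨γ₁, hγ₁, fun F γ hγ hle b₀ p₀ κ j₀ prm η hκ hpos hη μ μ' ρ ρ' hc hc' hB => ?_⟩
  obtain ⟨lam, C, w₀, ε, δ, j₁, hlam0, hlam1, hC, hw₀, hεδ, hεs, hδs, hDs, hdec, hj, hstep⟩ :=
    h F γ hγ hle b₀ p₀ κ j₀ prm η hκ hpos hη μ μ' ρ ρ' hc hc' hB
  obtain ⟨θ, C', hθ1, hC', halg⟩ := hP lam C hlam0 hlam1 hC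
  have hθ0 : 0 ≤ θ + 1 := by linarith
  refine ⟨θ, C', w₀, fun j => (θ + 1) * ε j, fun j => (θ + 1) * δ j, j₁, by linarith, hC', hw₀, fun j => ?_, hεs.mul_left _,
    hδs.mul_left _, ?_, ?_, hj, ?_⟩
  · exact ⟨mul_nonneg hθ0 (hεδ j).1, mul_nonneg hθ0 (hεδ j).2⟩
  · refine (hDs.mul_left (θ + 1)).congr fun i => ?_
    beta_reduce
    rw [tsum_mul_left]
  · have h := hdec.const_mul (θ + 1)
    rw [mul_zero] at h
    refine Filter.Tendsto.congr (fun j => ?_) h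
    beta_reduce
    rw [tsum_mul_left]
    ring
  intro j hjj c a w ha hw hV hadm
  have haw : a + w ≤ w₀ := by nlinarith
  obtain ⟨c', a', w', ha', hw', hA, hW, hadm'⟩ := hstep j hjj c a w ha hw haw hadm
  exact ⟨c', a', w', ha', hw', halg (ε j) (δ j) a w a' w' (hεδ j).1 (hεδ j).2 ha hw ha' hw' hA hW, hadm'⟩

/-- The composition applied to the stubs: the organ BY NAME, modulo exactly the two sorries above. -/
theorem oneStepBackwardContraction_of_stubs :
    Summit.QuantumFields.YangMills.Theses.BackwardLiouvilleRigidity.OneStepBackwardContraction :=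
  OneStepBackwardContraction_of stub_twoComponentStep stub_potentialForm

end Summit.QuantumFields.YangMills.Cruxes.OneStepBackwardContraction.BackwardLiouville
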